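/-
Copyright (c) 2026 the pub-hodgecm-mathlib formalisation cell (harness21).  Prover seat hodgecm-mathlib-K2Liu-p25 (g0), Track B «K2-LIT»,
#184♮ = hLiu418 = `stmt-HodgeConjecture-24832`; #42S organ S2, S2-asm road (γ): THE JUNCTION FRAME DATA for the closing file (S2 desk K2Liu-p05 (g6)
15:26:02Z «→ K2Liu-p25: `K2LiuArchJunctionFrameData`», LEAD F0P6-plan (g14) BATCH #47 (4)).  THEOREMS ONLY (no `def`, no `instance`, no notation,
no named-fact hypothesis, no `sorry`); generated by `K2/K2Liu-p25/g0/gen/gen_jfd.py` (binder bytes pasted from ★ σ15 ∕ ★ (r-b)-uniform).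
-/
import Summits.HodgeConjecture.HodgeConjecture.Theorems.K2LiuArchTensorPlaceSec          -- ★ K2E5-p16 (J2⊗-arch) `tensorEmb_archToAdelic_placeSec`, `signVec_tensor`
import Summits.HodgeConjecture.HodgeConjecture.Theorems.K2LiuArchTensorFrameChase        -- ★ K2E5-p16 FILE 2a `sumCongr_tensorEquiv_compatible` (+ ★ J0-a equivalences)
import Summits.HodgeConjecture.HodgeConjecture.Theorems.K2LiuArchSectionPlaceJunction    -- ★ `placeSecJ`, `placeSecJ_inl`
import Summits.HodgeConjecture.HodgeConjecture.Theorems.K2LiuArchOneParameterOrbitDefs   -- ★ `archEmb` (= `archToAdelic`, `rfl`)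
import Literature.NumberTheory.K2Lit.DoubledTensorEmbedding                              -- ★ `tensorEmb`
import HarnessLib

/-!
# Crux `HLiu418`, #42S organ S2, road (γ): THE JUNCTION FRAME DATA — the `(y, hy, hz, eP, eQ, hE)` package of ★ σ15 ∕ ★ (real) ∕ ★ D2, and the
# one-place homomorphism `ψ_σ : U(2,2) →* H(L⁺ ⊗ ℝ)` with its (J2⊗-arch) identity `hsec` in ★ (r-b)-uniform's bytes

Cell `hodgecm-mathlib`, crux item hLiu418 = `stmt-HodgeConjecture-24832` (helper lane `--supports`, count-neutral); S2 desk K2Liu-p05 (g6).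
The closing file `K2LiuArchSWSpanningStd` feeds ONE junction frame to ★ σ15 `K2LiuArchHermiteDatum.isArchDatum_hermiteSpan`, ★ (real) p861258
`K2LiuArchSWSystemRealiser.realiser_of_hK`, ★ D2 p861276 `K2LiuArchSWSystemDerivative.derivClause_archSWValue_hermite` and ★ (r-b)-uniform p860738.  This file
packages it once:
* §1 **`exists_junctionFrameData`** — for a real diagonal frame `dV′` of the big datum `𝕎 = 𝔻 ⊗ V′`: `∃ y hy hz eP eQ, hE` in ★ σ15's binder bytes VERBATIM
  (`y σ k := σ(dV′ k)`, `hz` = ★ `signVec_tensor`, `(eP σ, eQ σ)` = ★ J0-a `posIdxTensorEquiv` ∕ `negIdxTensorEquiv` keyed on `hz`, `hE` = ★ FILE 2a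
  `sumCongr_tensorEquiv_compatible`; the sign vector of `𝔻` does not vanish by ★ `signVec_ne_zero`);
* §2 **`relabel_relabel_toBig_relabel`** — the frame algebra: relabelling the small blocks `U(𝔻⁺_σ, 𝔻⁻_σ) ≃ U(2,2)` by `(eSp, eSq)` commutes with Konno–Konno's
  `toBig (·, 1)` through the induced relabelling of the junction blocks (matrix identity, sixteen block cases);
* §3 **`hsec_placeSec_relabel`** — for ONE real place `σ`, a one-place frame `(y, hy, hz, eP, eQ, hE)` (★ K2E5-p16's binders) and block identifications
  `eSp : Fin 2 ≃ 𝔻⁺_σ`, `eSq : Fin 2 ≃ 𝔻⁻_σ`: the homomorphism **`ψ := placeSec_𝔻 σ ∘ UForm.relabel eSp eSq : U(2,2) →* H(L⁺ ⊗ ℝ)`** satisfies ★ (r-b)-uniform's ∕ ★ D2's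
  `hsec` VERBATIM with `R := PosIdx y`, `S := NegIdx y` and the junction frame `eP′ := eP⁻¹ ≫ (eSp⁻¹ × 1 ⊕ eSq⁻¹ × 1)`, `eQ′ := eQ⁻¹ ≫ (eSp⁻¹ × 1 ⊕ eSq⁻¹ × 1)` —
  ★ `tensorEmb_archToAdelic_placeSec` + ★ `placeSecJ_inl` + §2.  (The same `ψ` is the one D1's frame letter (F2′) must be read against.)
References: [KonnoKonno2007, §3.1 (3.1)]; [Kudla1994, §2]; [HarrisKudlaSweet1996, §1 (1.8)]; [BorelJacquet1979, §4.1]; [MoeglinVignerasWaldspurger1987, Ch. 1 I.17].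
HONEST LABEL: HC_CM is proved only modulo the 7 printed citations (2 remaining named inputs: hLiu418 = stmt-HodgeConjecture-24832,
h413 = stmt-HodgeConjecture-24833) until rung 0 closes; count-neutral helper, closes no socket.
-/

set_option autoImplicit false
set_option linter.dupNamespace false -- the mandated namespace repeats `HodgeConjecture.HodgeConjecture`
set_option synthInstance.maxSize 512 -- `DecidableEq` of the nested block index (as ★ 3-b glue ∕ ★ `K2LiuWeilSeesawRelabel`)

noncomputable section

open scoped Matrix Kronecker Classical
open NumberField NumberField.InfinitePlace NumberField.mixedEmbedding IsDedekindDomain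
open Literature.NumberTheory.Automorphic Literature.NumberTheory.Automorphic.UnitaryGroup Literature.NumberTheory.Weil1964
open Literature.NumberTheory.GelbartRogawski1991 Literature.NumberTheory.GelbartRogawski1991.UnitaryDualPair
open Literature.NumberTheory.GelbartRogawski1991.UnitaryDualPair.LocalSplitting
open Literature.NumberTheory.GelbartRogawski1991.GRConstruction Literature.NumberTheory.K2Lit.SiegelDoubled
open Literature.RepresentationTheory.HeisenbergGroup Literature.Analysis.SegalBargmann
open Literature.RepresentationTheory.KonnoKonno2007 Literature.RepresentationTheory.KonnoKonno2007.RealDualPair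
open Summit.HodgeConjecture.HodgeConjecture.Cruxes.HLiu418 Summit.HodgeConjecture.HodgeConjecture.Cruxes.HLiu418.K2LiuArchSectionPlaceBlock
open Summit.HodgeConjecture.HodgeConjecture.Cruxes.HLiu418.K2LiuArchTensorPlaceSec

namespace Summit.HodgeConjecture.HodgeConjecture.Cruxes.HLiu418.K2LiuArchJunctionFrameData

/-! ## §2 (frame algebra) relabelling the small blocks commutes with `toBig (·, 1)` -/

section Algebra

variable {P Q R S : Type} [Fintype P] [DecidableEq P] [Fintype Q] [DecidableEq Q] [Fintype R] [DecidableEq R] [Fintype S] [DecidableEq S]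
  {P' Q' : Type} [Fintype P'] [DecidableEq P'] [Fintype Q'] [DecidableEq Q']

/-- **`toBig (·, 1)` IS NATURAL UNDER RELABELLING THE SMALL BLOCKS**: for `eSp : Fin 2 ≃ P`, `eSq : Fin 2 ≃ Q`, a frame `(eP, eQ)` of the big blocks and the induced junction
frame `eP′ := eP⁻¹ ≫ (eSp⁻¹ × 1 ⊕ eSq⁻¹ × 1)`, `eQ′ := eQ⁻¹ ≫ (eSp⁻¹ × 1 ⊕ eSq⁻¹ × 1)`:
`relabel eP′ eQ′ (relabel eP eQ (toBig P Q R S (relabel eSp eSq h, 1))) = toBig (Fin 2) (Fin 2) R S (h, 1)` (matrices: `reindex`ed Kronecker products `h ⊗ 1`, entry by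
entry on the sixteen blocks). [cite: KonnoKonno2007, §3.1 (3.1)] [cite: MoeglinVignerasWaldspurger1987, Ch. 1 I.17] -/
theorem relabel_relabel_toBig_relabel (eSp : Fin 2 ≃ P) (eSq : Fin 2 ≃ Q) (eP : (P × R) ⊕ (Q × S) ≃ P') (eQ : (P × S) ⊕ (Q × R) ≃ Q') (h : UForm (Fin 2) (Fin 2)) :
    UForm.relabel P' Q' ((Fin 2 × R) ⊕ (Fin 2 × S)) ((Fin 2 × S) ⊕ (Fin 2 × R))
        (eP.symm.trans (Equiv.sumCongr (eSp.symm.prodCongr (Equiv.refl R)) (eSq.symm.prodCongr (Equiv.refl S))))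
        (eQ.symm.trans (Equiv.sumCongr (eSp.symm.prodCongr (Equiv.refl S)) (eSq.symm.prodCongr (Equiv.refl R))))
        (UForm.relabel ((P × R) ⊕ (Q × S)) ((P × S) ⊕ (Q × R)) P' Q' eP eQ
          (toBig P Q R S (UForm.relabel (Fin 2) (Fin 2) P Q eSp eSq h, 1))) =
      toBig (Fin 2) (Fin 2) R S (h, 1) := by
  apply Subtype.ext
  apply Units.ext
  rw [UForm.coe_relabel, UForm.coe_relabel, coe_toBig, coe_toBig]
  ext i j
  simp only [UForm.coe_relabel, OneMemClass.coe_one, Units.val_one, Matrix.reindex_apply, Matrix.submatrix_apply, Matrix.kroneckerMap_apply,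
    Equiv.sumCongr_symm, Equiv.sumCongr_apply]
  rcases i with ((⟨a, r⟩ | ⟨b, s⟩) | (⟨a, s⟩ | ⟨b, r⟩)) <;> rcases j with ((⟨a', r'⟩ | ⟨b', s'⟩) | (⟨a', s'⟩ | ⟨b', r'⟩)) <;>
    simp [Equiv.prodCongr_apply, dpEquiv_symm_inl_inl, dpEquiv_symm_inl_inr, dpEquiv_symm_inr_inl, dpEquiv_symm_inr_inr, Matrix.one_apply]

end Algebra

section Frame

variable (L : Type) [Field L] [NumberField L] [IsCMField L]
variable {N M n : ℕ} (e : Fin N × Fin M ≃ Fin n)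
  (dV : Fin N → L) (hdV : ∀ i, IsCMField.complexConj L (dV i) = dV i) (hdV0 : ∀ i, dV i ≠ 0)
  (dW : Fin M → L) (hdW : ∀ i, IsCMField.complexConj L (dW i) = dW i) (hdW0 : ∀ i, dW i ≠ 0)
variable {M₂ M' n' : ℕ} (eW : Fin M × Fin M₂ ≃ Fin M') (e' : Fin N × Fin M' ≃ Fin n')
  (dV' : Fin M₂ → L) (hdV' : ∀ k, IsCMField.complexConj L (dV' k) = dV' k) (hdV'0 : ∀ k, dV' k ≠ 0)

-- the CM sign frames of the big datum elaborate slowly (as ★ σ15 ∕ ★ 3-b: 4 000 000 heartbeats)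
set_option maxHeartbeats 4000000

/-! ## §1 The junction frame data of a real diagonal frame -/

include hdV0 hdW0 hdV'0 in
/-- **THE JUNCTION FRAME DATA EXIST** (★ σ15's binders `y hy hz eP eQ hE` VERBATIM, as an `∃`-package): `y σ k := σ(dV′ k)` (non-zero: `dV′ k ≠ 0`), `hz` = ★ K2E5-p16
`signVec_tensor`, `(eP σ, eQ σ)` = ★ J0-a's tensor sign equivalences keyed on `hz`, `hE` = ★ FILE 2a `sumCongr_tensorEquiv_compatible` (the sign vector of `𝔻` never vanishes,
★ `signVec_ne_zero`). [cite: KonnoKonno2007, §3.1 (3.1)] [cite: Kudla1994, §2] -/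
theorem exists_junctionFrameData :
    ∃ (y : ∀ σ : {v : InfinitePlace (Fp L) // v.IsReal}, Fin M₂ → ℝ) (_ : ∀ σ : {v : InfinitePlace (Fp L) // v.IsReal}, ∀ k, (y σ) k ≠ 0) (_ : ∀ σ : {v : InfinitePlace (Fp L) // v.IsReal}, ∀ j, signVec (cmPlaceOver L)
        (fun k => Sum.elim (cmGramEntry L e' dV hdV (tensorFrame L dW eW dV') (tensorFrame_real L dW hdW eW dV' hdV'))
          (-cmGramEntry L e' dV hdV (tensorFrame L dW eW dV') (tensorFrame_real L dW hdW eW dV' hdV')) ((LocalSplitting.e₂ n').symm k))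
        (imagUnit L) σ j =
      signVec (cmPlaceOver L)
          (fun k => Sum.elim (cmGramEntry L e dV hdV dW hdW) (-cmGramEntry L e dV hdV dW hdW) ((LocalSplitting.e₂ n).symm k)) (imagUnit L) σ
          ((epsD e eW e').symm j).1 * (y σ) ((epsD e eW e').symm j).2) (eP : ∀ σ : {v : InfinitePlace (Fp L) // v.IsReal}, (PosIdx (signVec (cmPlaceOver L)
          (fun k => Sum.elim (cmGramEntry L e dV hdV dW hdW) (-cmGramEntry L e dV hdV dW hdW) ((LocalSplitting.e₂ n).symm k)) (imagUnit L) σ) × PosIdx (y σ)) ⊕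
        (NegIdx (signVec (cmPlaceOver L)
          (fun k => Sum.elim (cmGramEntry L e dV hdV dW hdW) (-cmGramEntry L e dV hdV dW hdW) ((LocalSplitting.e₂ n).symm k)) (imagUnit L) σ) × NegIdx (y σ)) ≃
      PosIdx (signVec (cmPlaceOver L)
        (fun k => Sum.elim (cmGramEntry L e' dV hdV (tensorFrame L dW eW dV') (tensorFrame_real L dW hdW eW dV' hdV'))
          (-cmGramEntry L e' dV hdV (tensorFrame L dW eW dV') (tensorFrame_real L dW hdW eW dV' hdV')) ((LocalSplitting.e₂ n').symm k))
        (imagUnit L) σ)) (eQ : ∀ σ : {v : InfinitePlace (Fp L) // v.IsReal}, (PosIdx (signVec (cmPlaceOver L)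
          (fun k => Sum.elim (cmGramEntry L e dV hdV dW hdW) (-cmGramEntry L e dV hdV dW hdW) ((LocalSplitting.e₂ n).symm k)) (imagUnit L) σ) × NegIdx (y σ)) ⊕
        (NegIdx (signVec (cmPlaceOver L)
          (fun k => Sum.elim (cmGramEntry L e dV hdV dW hdW) (-cmGramEntry L e dV hdV dW hdW) ((LocalSplitting.e₂ n).symm k)) (imagUnit L) σ) × PosIdx (y σ)) ≃
      NegIdx (signVec (cmPlaceOver L)
        (fun k => Sum.elim (cmGramEntry L e' dV hdV (tensorFrame L dW eW dV') (tensorFrame_real L dW hdW eW dV' hdV'))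
          (-cmGramEntry L e' dV hdV (tensorFrame L dW eW dV') (tensorFrame_real L dW hdW eW dV' hdV')) ((LocalSplitting.e₂ n').symm k))
        (imagUnit L) σ)), ∀ σ : {v : InfinitePlace (Fp L) // v.IsReal}, ∀ i, (dpEquiv _ _ _ _).symm (((eP σ).sumCongr (eQ σ)).symm i) =
      (signSplit (signVec (cmPlaceOver L)
          (fun k => Sum.elim (cmGramEntry L e dV hdV dW hdW) (-cmGramEntry L e dV hdV dW hdW) ((LocalSplitting.e₂ n).symm k)) (imagUnit L) σ)
        ((epsD e eW e').symm ((signSplit (signVec (cmPlaceOver L)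
          (fun k => Sum.elim (cmGramEntry L e' dV hdV (tensorFrame L dW eW dV') (tensorFrame_real L dW hdW eW dV' hdV'))
            (-cmGramEntry L e' dV hdV (tensorFrame L dW eW dV') (tensorFrame_real L dW hdW eW dV' hdV')) ((LocalSplitting.e₂ n').symm k))
          (imagUnit L) σ)).symm i)).1,
       signSplit (y σ) ((epsD e eW e').symm ((signSplit (signVec (cmPlaceOver L)
          (fun k => Sum.elim (cmGramEntry L e' dV hdV (tensorFrame L dW eW dV') (tensorFrame_real L dW hdW eW dV' hdV'))
            (-cmGramEntry L e' dV hdV (tensorFrame L dW eW dV') (tensorFrame_real L dW hdW eW dV' hdV')) ((LocalSplitting.e₂ n').symm k))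
          (imagUnit L) σ)).symm i)).2) := by
  -- the sign vectors of `𝔻` do not vanish
  have hx : ∀ (σ : {v : InfinitePlace (Fp L) // v.IsReal}) i, signVec (cmPlaceOver L)
      (fun k => Sum.elim (cmGramEntry L e dV hdV dW hdW) (-cmGramEntry L e dV hdV dW hdW) ((LocalSplitting.e₂ n).symm k)) (imagUnit L) σ i ≠ 0 :=
    fun σ => signVec_ne_zero (IsCMField.complexConj_ne_one L) (cmPlaceOver_smul L) (complexConj_imagUnit L) (imagUnit_ne_zero L)
      (gramD_gram_realDiagonal_entry_ne_zero L e dV hdV dW hdW hdV0 hdW0) σ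
  -- `y σ k := σ(dV′ k)`
  have hy : ∀ (σ : {v : InfinitePlace (Fp L) // v.IsReal}) (k : Fin M₂),
      embedding_of_isReal σ.2 (⟨dV' k, (IsCMField.complexConj_eq_self_iff (K := L) (dV' k)).1 (hdV' _)⟩ : Fp L) ≠ 0 := by
    intro σ k h0
    have h1 : (⟨dV' k, (IsCMField.complexConj_eq_self_iff (K := L) (dV' k)).1 (hdV' _)⟩ : Fp L) = 0 :=
      (map_eq_zero_iff _ (embedding_of_isReal σ.2).injective).1 h0
    exact hdV'0 k (congrArg Subtype.val h1)
  have hz := fun (σ : {v : InfinitePlace (Fp L) // v.IsReal}) (j : Fin (n' + n')) => signVec_tensor L e dV hdV dW hdW eW e' dV' hdV' σ j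
  -- ★ FILE 2a: compatible frame identifications exist at every real place
  have hEx := fun σ : {v : InfinitePlace (Fp L) // v.IsReal} =>
    (⟨_, _, K2LiuArchTensorFrameChase.sumCongr_tensorEquiv_compatible _ _ (epsD e eW e') (hx σ) (hy σ) _ (hz σ)⟩ :
      ∃ (eP :(PosIdx (signVec (cmPlaceOver L)
          (fun k => Sum.elim (cmGramEntry L e dV hdV dW hdW) (-cmGramEntry L e dV hdV dW hdW) ((LocalSplitting.e₂ n).symm k)) (imagUnit L) σ) × PosIdx (fun k : Fin M₂ => embedding_of_isReal σ.2 (⟨dV' k, (IsCMField.complexConj_eq_self_iff (K := L) (dV' k)).1 (hdV' _)⟩ : Fp L))) ⊕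
        (NegIdx (signVec (cmPlaceOver L)
          (fun k => Sum.elim (cmGramEntry L e dV hdV dW hdW) (-cmGramEntry L e dV hdV dW hdW) ((LocalSplitting.e₂ n).symm k)) (imagUnit L) σ) × NegIdx (fun k : Fin M₂ => embedding_of_isReal σ.2 (⟨dV' k, (IsCMField.complexConj_eq_self_iff (K := L) (dV' k)).1 (hdV' _)⟩ : Fp L))) ≃
      PosIdx (signVec (cmPlaceOver L)
        (fun k => Sum.elim (cmGramEntry L e' dV hdV (tensorFrame L dW eW dV') (tensorFrame_real L dW hdW eW dV' hdV'))
          (-cmGramEntry L e' dV hdV (tensorFrame L dW eW dV') (tensorFrame_real L dW hdW eW dV' hdV')) ((LocalSplitting.e₂ n').symm k))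
        (imagUnit L) σ)) (eQ :(PosIdx (signVec (cmPlaceOver L)
          (fun k => Sum.elim (cmGramEntry L e dV hdV dW hdW) (-cmGramEntry L e dV hdV dW hdW) ((LocalSplitting.e₂ n).symm k)) (imagUnit L) σ) × NegIdx (fun k : Fin M₂ => embedding_of_isReal σ.2 (⟨dV' k, (IsCMField.complexConj_eq_self_iff (K := L) (dV' k)).1 (hdV' _)⟩ : Fp L))) ⊕
        (NegIdx (signVec (cmPlaceOver L)
          (fun k => Sum.elim (cmGramEntry L e dV hdV dW hdW) (-cmGramEntry L e dV hdV dW hdW) ((LocalSplitting.e₂ n).symm k)) (imagUnit L) σ) × PosIdx (fun k : Fin M₂ => embedding_of_isReal σ.2 (⟨dV' k, (IsCMField.complexConj_eq_self_iff (K := L) (dV' k)).1 (hdV' _)⟩ : Fp L))) ≃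
      NegIdx (signVec (cmPlaceOver L)
        (fun k => Sum.elim (cmGramEntry L e' dV hdV (tensorFrame L dW eW dV') (tensorFrame_real L dW hdW eW dV' hdV'))
          (-cmGramEntry L e' dV hdV (tensorFrame L dW eW dV') (tensorFrame_real L dW hdW eW dV' hdV')) ((LocalSplitting.e₂ n').symm k))
        (imagUnit L) σ)),∀ i, (dpEquiv _ _ _ _).symm ((eP.sumCongr eQ).symm i) =
      (signSplit (signVec (cmPlaceOver L)
          (fun k => Sum.elim (cmGramEntry L e dV hdV dW hdW) (-cmGramEntry L e dV hdV dW hdW) ((LocalSplitting.e₂ n).symm k)) (imagUnit L) σ)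
        ((epsD e eW e').symm ((signSplit (signVec (cmPlaceOver L)
          (fun k => Sum.elim (cmGramEntry L e' dV hdV (tensorFrame L dW eW dV') (tensorFrame_real L dW hdW eW dV' hdV'))
            (-cmGramEntry L e' dV hdV (tensorFrame L dW eW dV') (tensorFrame_real L dW hdW eW dV' hdV')) ((LocalSplitting.e₂ n').symm k))
          (imagUnit L) σ)).symm i)).1,
       signSplit (fun k : Fin M₂ => embedding_of_isReal σ.2 (⟨dV' k, (IsCMField.complexConj_eq_self_iff (K := L) (dV' k)).1 (hdV' _)⟩ : Fp L)) ((epsD e eW e').symm ((signSplit (signVec (cmPlaceOver L)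
          (fun k => Sum.elim (cmGramEntry L e' dV hdV (tensorFrame L dW eW dV') (tensorFrame_real L dW hdW eW dV' hdV'))
            (-cmGramEntry L e' dV hdV (tensorFrame L dW eW dV') (tensorFrame_real L dW hdW eW dV' hdV')) ((LocalSplitting.e₂ n').symm k))
          (imagUnit L) σ)).symm i)).2))
  choose eP eQ hE using hEx
  exact ⟨fun σ k => embedding_of_isReal σ.2 (⟨dV' k, (IsCMField.complexConj_eq_self_iff (K := L) (dV' k)).1 (hdV' _)⟩ : Fp L), hy, hz, eP, eQ, hE⟩

/-! ## §3 The one-place homomorphism `ψ_σ := placeSec_𝔻 σ ∘ relabel (eSp, eSq)` and its (J2⊗-arch) identity -/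

include hdV0 hdW0 hdV'0 in
/-- **`hsec` FOR `ψ := placeSec_𝔻 σ ∘ UForm.relabel eSp eSq`** (★ (r-b)-uniform p860738's ∕ ★ D2 p861276's binder VERBATIM with `R := PosIdx y`, `S := NegIdx y`, the junction
frame `eP′ := eP⁻¹ ≫ (eSp⁻¹ × 1 ⊕ eSq⁻¹ × 1)`, `eQ′ := eQ⁻¹ ≫ (eSp⁻¹ × 1 ⊕ eSq⁻¹ × 1)`): for a one-place frame `(y, hy, hz, eP, eQ, hE)` at the real place `σ` (★ K2E5-p16
`tensorEmb_archToAdelic_placeSec`'s binders) and block identifications `eSp : Fin 2 ≃ 𝔻⁺_σ`, `eSq : Fin 2 ≃ 𝔻⁻_σ`,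
`tensorEmb ((ψ h, 1)) = (placeSecJ_𝕎 σ eP′ eQ′ (toBig (h, 1), 1), 1)` for every `h ∈ U(2,2)` — ★ `tensorEmb_archToAdelic_placeSec` + ★ `placeSecJ_inl` + §2.
[cite: KonnoKonno2007, §3.1 (3.1)] [cite: Kudla1994, §2] [cite: HarrisKudlaSweet1996, §1 (1.8)] [cite: BorelJacquet1979, §4.1] -/
theorem hsec_placeSec_relabel (σ : {v : InfinitePlace (Fp L) // v.IsReal})
    (y : Fin M₂ → ℝ) (hy : ∀ k, y k ≠ 0)
    (hz : ∀ j, signVec (cmPlaceOver L)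
        (fun k => Sum.elim (cmGramEntry L e' dV hdV (tensorFrame L dW eW dV') (tensorFrame_real L dW hdW eW dV' hdV'))
          (-cmGramEntry L e' dV hdV (tensorFrame L dW eW dV') (tensorFrame_real L dW hdW eW dV' hdV')) ((LocalSplitting.e₂ n').symm k))
        (imagUnit L) σ j =
      signVec (cmPlaceOver L)
          (fun k => Sum.elim (cmGramEntry L e dV hdV dW hdW) (-cmGramEntry L e dV hdV dW hdW) ((LocalSplitting.e₂ n).symm k)) (imagUnit L) σ
          ((epsD e eW e').symm j).1 * y ((epsD e eW e').symm j).2)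
    (eP : (PosIdx (signVec (cmPlaceOver L)
          (fun k => Sum.elim (cmGramEntry L e dV hdV dW hdW) (-cmGramEntry L e dV hdV dW hdW) ((LocalSplitting.e₂ n).symm k)) (imagUnit L) σ) × PosIdx y) ⊕
        (NegIdx (signVec (cmPlaceOver L)
          (fun k => Sum.elim (cmGramEntry L e dV hdV dW hdW) (-cmGramEntry L e dV hdV dW hdW) ((LocalSplitting.e₂ n).symm k)) (imagUnit L) σ) × NegIdx y) ≃
      PosIdx (signVec (cmPlaceOver L)
        (fun k => Sum.elim (cmGramEntry L e' dV hdV (tensorFrame L dW eW dV') (tensorFrame_real L dW hdW eW dV' hdV'))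
          (-cmGramEntry L e' dV hdV (tensorFrame L dW eW dV') (tensorFrame_real L dW hdW eW dV' hdV')) ((LocalSplitting.e₂ n').symm k))
        (imagUnit L) σ))
    (eQ : (PosIdx (signVec (cmPlaceOver L)
          (fun k => Sum.elim (cmGramEntry L e dV hdV dW hdW) (-cmGramEntry L e dV hdV dW hdW) ((LocalSplitting.e₂ n).symm k)) (imagUnit L) σ) × NegIdx y) ⊕
        (NegIdx (signVec (cmPlaceOver L)
          (fun k => Sum.elim (cmGramEntry L e dV hdV dW hdW) (-cmGramEntry L e dV hdV dW hdW) ((LocalSplitting.e₂ n).symm k)) (imagUnit L) σ) × PosIdx y) ≃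
      NegIdx (signVec (cmPlaceOver L)
        (fun k => Sum.elim (cmGramEntry L e' dV hdV (tensorFrame L dW eW dV') (tensorFrame_real L dW hdW eW dV' hdV'))
          (-cmGramEntry L e' dV hdV (tensorFrame L dW eW dV') (tensorFrame_real L dW hdW eW dV' hdV')) ((LocalSplitting.e₂ n').symm k))
        (imagUnit L) σ))
    (hE : ∀ i, (dpEquiv _ _ _ _).symm ((eP.sumCongr eQ).symm i) =
      (signSplit (signVec (cmPlaceOver L)
          (fun k => Sum.elim (cmGramEntry L e dV hdV dW hdW) (-cmGramEntry L e dV hdV dW hdW) ((LocalSplitting.e₂ n).symm k)) (imagUnit L) σ)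
        ((epsD e eW e').symm ((signSplit (signVec (cmPlaceOver L)
          (fun k => Sum.elim (cmGramEntry L e' dV hdV (tensorFrame L dW eW dV') (tensorFrame_real L dW hdW eW dV' hdV'))
            (-cmGramEntry L e' dV hdV (tensorFrame L dW eW dV') (tensorFrame_real L dW hdW eW dV' hdV')) ((LocalSplitting.e₂ n').symm k))
          (imagUnit L) σ)).symm i)).1,
       signSplit y ((epsD e eW e').symm ((signSplit (signVec (cmPlaceOver L)
          (fun k => Sum.elim (cmGramEntry L e' dV hdV (tensorFrame L dW eW dV') (tensorFrame_real L dW hdW eW dV' hdV'))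
            (-cmGramEntry L e' dV hdV (tensorFrame L dW eW dV') (tensorFrame_real L dW hdW eW dV' hdV')) ((LocalSplitting.e₂ n').symm k))
          (imagUnit L) σ)).symm i)).2))
    (eSp : Fin 2 ≃ (PosIdx (signVec (cmPlaceOver L) (fun k => Sum.elim (cmGramEntry L e dV hdV dW hdW) (-cmGramEntry L e dV hdV dW hdW) ((LocalSplitting.e₂ n).symm k)) (imagUnit L) σ))) (eSq : Fin 2 ≃ (NegIdx (signVec (cmPlaceOver L) (fun k => Sum.elim (cmGramEntry L e dV hdV dW hdW) (-cmGramEntry L e dV hdV dW hdW) ((LocalSplitting.e₂ n).symm k)) (imagUnit L) σ))) :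
    ∀ h : UForm (Fin 2) (Fin 2),
      tensorEmb L e dV hdV dW hdW eW e' dV' hdV' (K2LiuArchOneParameterOrbitDefs.archEmb (Fp L) L (IsCMField.complexConj L) (n + n) (hermD L e dV hdV dW hdW) (((placeSec L (IsCMField.complexConj L) (n + n) (IsCMField.complexConj_ne_one L) (cmPlaceOver L) (cmPlaceOver_smul L) _ (gramD_gram_realDiagonal_entry_ne_zero L e dV hdV dW hdW hdV0 hdW0) (complexConj_imagUnit L) (imagUnit_ne_zero L) σ (cmPlaceOver_comap L) (gramD_eq_diagonal_cm L e dV hdV dW hdW) (J := hermD L e dV hdV dW hdW) rfl (complexConj_smul_infinitePlace L)).comp (UForm.relabel (Fin 2) (Fin 2) (PosIdx (signVec (cmPlaceOver L) (fun k => Sum.elim (cmGramEntry L e dV hdV dW hdW) (-cmGramEntry L e dV hdV dW hdW) ((LocalSplitting.e₂ n).symm k)) (imagUnit L) σ)) (NegIdx (signVec (cmPlaceOver L) (fun k => Sum.elim (cmGramEntry L e dV hdV dW hdW) (-cmGramEntry L e dV hdV dW hdW) ((LocalSplitting.e₂ n).symm k)) (imagUnit L) σ)) eSp eSq).toMonoidHom)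 h)) =
        K2LiuArchOneParameterOrbitDefs.archEmb (Fp L) L (IsCMField.complexConj L) (n' + n') (hermD L e' dV hdV (tensorFrame L dW eW dV') (tensorFrame_real L dW hdW eW dV' hdV'))
          (placeSecJ L (IsCMField.complexConj L) (n' + n') (IsCMField.complexConj_ne_one L) (cmPlaceOver L) (cmPlaceOver_smul L) _
                (gramD_gram_realDiagonal_entry_ne_zero L e' dV hdV (tensorFrame L dW eW dV') (tensorFrame_real L dW hdW eW dV' hdV') hdV0 (tensorFrame_ne_zero L dW eW dV' hdW0 hdV'0)) (complexConj_imagUnit L) (imagUnit_ne_zero L) σ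
                (cmPlaceOver_comap L) (gramD_eq_diagonal_cm L e' dV hdV (tensorFrame L dW eW dV') (tensorFrame_real L dW hdW eW dV' hdV')) (J := hermD L e' dV hdV (tensorFrame L dW eW dV') (tensorFrame_real L dW hdW eW dV' hdV')) rfl
                (complexConj_smul_infinitePlace L) (eP.symm.trans (Equiv.sumCongr (eSp.symm.prodCongr (Equiv.refl (PosIdx y))) (eSq.symm.prodCongr (Equiv.refl (NegIdx y))))) (eQ.symm.trans (Equiv.sumCongr (eSp.symm.prodCongr (Equiv.refl (NegIdx y))) (eSq.symm.prodCongr (Equiv.refl (PosIdx y))))) ((toBig (Fin 2) (Fin 2) (PosIdx y) (NegIdx y) (h, 1), (1 : UForm Unit Empty)) : Ginf ((Fin 2 × PosIdx y) ⊕ (Fin 2 × NegIdx y)) ((Fin 2 × NegIdx y) ⊕ (Fin 2 × PosIdx y)) Unit Empty)) := by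
  intro h
  rw [K2LiuArchOneParameterOrbitDefs.archEmb_eq_archToAdelic, K2LiuArchOneParameterOrbitDefs.archEmb_eq_archToAdelic, MonoidHom.comp_apply,
    placeSecJ_inl]
  rw [show ((UForm.relabel (Fin 2) (Fin 2) (PosIdx (signVec (cmPlaceOver L) (fun k => Sum.elim (cmGramEntry L e dV hdV dW hdW) (-cmGramEntry L e dV hdV dW hdW) ((LocalSplitting.e₂ n).symm k)) (imagUnit L) σ)) (NegIdx (signVec (cmPlaceOver L) (fun k => Sum.elim (cmGramEntry L e dV hdV dW hdW) (-cmGramEntry L e dV hdV dW hdW) ((LocalSplitting.e₂ n).symm k)) (imagUnit L) σ)) eSp eSq).toMonoidHom h) = (UForm.relabel (Fin 2) (Fin 2) (PosIdx (signVec (cmPlaceOver L) (fun k => Sum.elim (cmGramEntry L e dV hdV dW hdW) (-cmGramEntry L e dV hdV dW hdW) ((LocalSplitting.e₂ n).symm k)) (imagUnit L) σ)) (NegIdx (signVec (cmPlaceOver L) (fun k => Sum.elim (cmGramEntry L e dV hdV dW hdW) (-cmGramEntry L e dV hdV dW hdW) ((LocalSplitting.e₂ n).symm k)) (imagUnit L)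 σ)) eSp eSq) h from rfl,
    tensorEmb_archToAdelic_placeSec L e dV hdV dW hdW eW e' dV' hdV' hdV0 hdW0 hdV'0 σ ((UForm.relabel (Fin 2) (Fin 2) (PosIdx (signVec (cmPlaceOver L) (fun k => Sum.elim (cmGramEntry L e dV hdV dW hdW) (-cmGramEntry L e dV hdV dW hdW) ((LocalSplitting.e₂ n).symm k)) (imagUnit L) σ)) (NegIdx (signVec (cmPlaceOver L) (fun k => Sum.elim (cmGramEntry L e dV hdV dW hdW) (-cmGramEntry L e dV hdV dW hdW) ((LocalSplitting.e₂ n).symm k)) (imagUnit L) σ)) eSp eSq) h) y hy hz eP eQ hE]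
  congr 2
  rw [eq_comm, ContinuousMulEquiv.symm_apply_eq]
  exact (relabel_relabel_toBig_relabel eSp eSq eP eQ h).symm

end Frame

end Summit.HodgeConjecture.HodgeConjecture.Cruxes.HLiu418.K2LiuArchJunctionFrameData

end
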